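import Summits.QuantumFields.YangMills.Theorems.BalabanUVNodesPortS1ZkBasis

/-!
# NODE O port PT-A — THE COAREA ∕ SYLVESTER BRIDGE for the (1.4) normalisation: print's `Z^{(k)} = ∫dB δ(Q̃B) e^{−½⟨B,ΔB⟩}` read (i) against an ORTHONORMAL basis `N` of `ker Q̃`
# with the δ-function's Jacobian `det(Q̃Q̃ᵀ)^{−1∕2}` (CRIT-1 §D-17.Z″ `recordZkCan`, object of record) and (ii) against print's GRAPH COORDINATES over the non-`b₀` variables with the
# elimination Jacobian `|det Q̃|_{b₀}|⁻¹` (`recordZkLoc`, p.268 «the remaining variables B … B′ = CB») — THE SAME NUMBER: `det(Q̃Q̃ᵀ)^{−1∕2}·Z14 S N = |det Q̃|_{b₀}|⁻¹·Z14 S C_graph`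

Cell `ym-nodeO-ideate`, porter seat `ymgap-nodeO-port-PTA-1` (gen 3); `--supports stmt-QuantumFields-27930` (helper; the «porter-sized bridge» of CRIT-1's Z-NORM ruling 02:19:22Z, OBJECT-FREE —
instantiate at DEF-1's `recordZkCan`∕`recordZkLoc` when ed.15d lands).  [I] = [Balaban1987RG1].  Block form: the linearised constraint `Q̃ = [A₁ A₂] : ℝ^{m ⊕ p} → ℝ^m` split into its `b₀`-block
`A₁` (square, invertible — print's «h is uniquely defined») and the rest `A₂`; graph parametrisation `C := [−A₁⁻¹A₂; 1] : ℝ^p → ℝ^{m ⊕ p}`.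
* §1 `graphC_def`∕`mul_graphC` — `Q̃·C = 0`; `transpose_graphC_mul_graphC` — `CᵀC = 1 + XᵀX`, `X = A₁⁻¹A₂`; `mul_transpose_eq` — `Q̃Q̃ᵀ = A₁(1 + XXᵀ)A₁ᵀ`;
  ★ `det_mul_transpose_eq` — `det(Q̃Q̃ᵀ) = (det A₁)²·det(CᵀC)` (Sylvester `Matrix.det_one_add_mul_comm`).
* §2 for `N` with orthonormal columns (`NᵀN = 1`) spanning the kernel (`N·Nᵀ·C = C` — the projector fixes the graph columns): `det(NᵀC)² = det(CᵀC)`, ★ `Z14_graph_eq`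
  `Z14 S C = Z14 S N ∕ √det(CᵀC)` (`Z14_basis_change`).
* §3 ★★ `zCan_eq_zLoc` — `(√det(Q̃Q̃ᵀ))⁻¹ · Z14 S N = |det A₁|⁻¹ · Z14 S C`.
* §4 (v2 APPEND) ★ `sqrt_gram_mul_Z14_basis_change` — `√det(CᵀC)·Z14 S C` is BASIS-FREE: a canonical (1.4) from ANY kernel basis (DEF-1's `recordCop`), no orthonormal carrier needed.

HONEST FRAMING.  Linear algebra; NOTHING of Bałaban asserted (not the invertibility of the record's `b₀`-block, not positivity); 27930 OPEN; K0⁷ NOT closed; NODE O 0∕1; COUNT 8∕28 · K 1∕4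
UNMOVED; finite `𝕋⁴_{L^K}` at fixed ε — NOT continuum ∕ OS ∕ Clay; **the Yang–Mills mass gap is NOT proved by any of this.**  No `sorry`, no `def`, no `instance`; standard axioms.
-/

noncomputable section

namespace Summit.QuantumFields.YangMills.Theorems.BalabanUVNodesPortS1

open Literature.MathematicalPhysics.QuantumFieldTheory.Balaban1983to89
open _root_.Matrix

variable {m p : Type*} [Fintype m] [Fintype p] [DecidableEq m] [DecidableEq p]

/-! ## §1  The graph parametrisation of `ker [A₁ A₂]` and Sylvester -/

/-- `Q̃·C = 0` for the graph parametrisation `C = [−A₁⁻¹A₂; 1]` (`A₁` invertible). [cite: Balaban1987RG1, p.267–268 (LQ̃h = I, B′ = CB)] -/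
theorem fromCols_mul_graphC (A₁ : Matrix m m ℝ) (A₂ : Matrix m p ℝ) (hA : IsUnit A₁.det) :
    fromCols A₁ A₂ * fromRows (-(A₁⁻¹ * A₂)) (1 : Matrix p p ℝ) = 0 := by
  rw [fromCols_mul_fromRows, Matrix.mul_neg, ← Matrix.mul_assoc, Matrix.mul_nonsing_inv _ hA, Matrix.one_mul, Matrix.mul_one,
    neg_add_cancel]

/-- `CᵀC = 1 + XᵀX`, `X = A₁⁻¹A₂`. [cite: Balaban1987RG1, p.268 (bookkeeping)] -/
theorem transpose_graphC_mul_graphC (A₁ : Matrix m m ℝ) (A₂ : Matrix m p ℝ) :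
    (fromRows (-(A₁⁻¹ * A₂)) (1 : Matrix p p ℝ))ᵀ * fromRows (-(A₁⁻¹ * A₂)) (1 : Matrix p p ℝ) = 1 + (A₁⁻¹ * A₂)ᵀ * (A₁⁻¹ * A₂) := by
  rw [transpose_fromRows, fromCols_mul_fromRows, transpose_neg, transpose_one, Matrix.neg_mul, Matrix.mul_neg, neg_neg, Matrix.one_mul, add_comm]

omit [DecidableEq p] in
/-- `Q̃Q̃ᵀ = A₁(1 + XXᵀ)A₁ᵀ`, `X = A₁⁻¹A₂` (`A₁` invertible). [cite: Balaban1987RG1, p.268 (bookkeeping)] -/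
theorem fromCols_mul_transpose_eq (A₁ : Matrix m m ℝ) (A₂ : Matrix m p ℝ) (hA : IsUnit A₁.det) :
    fromCols A₁ A₂ * (fromCols A₁ A₂)ᵀ = A₁ * (1 + (A₁⁻¹ * A₂) * (A₁⁻¹ * A₂)ᵀ) * A₁ᵀ := by
  rw [transpose_fromCols, fromCols_mul_fromRows]
  have h2 : A₂ = A₁ * (A₁⁻¹ * A₂) := by rw [← Matrix.mul_assoc, Matrix.mul_nonsing_inv _ hA, Matrix.one_mul]
  conv_lhs => rw [h2]
  rw [transpose_mul A₁]
  simp only [Matrix.mul_add, Matrix.mul_one, Matrix.add_mul, Matrix.mul_assoc]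

/-- ★ **SYLVESTER**: `det(Q̃Q̃ᵀ) = (det A₁)² · det(CᵀC)` — the coarea Jacobian of the linear constraint against an orthonormal kernel basis equals the `b₀`-elimination Jacobian squared
times the Gram determinant of the graph parametrisation (`Matrix.det_one_add_mul_comm`). [cite: Balaban1987RG1, (1.4) p.260, p.268] -/
theorem det_fromCols_mul_transpose_eq (A₁ : Matrix m m ℝ) (A₂ : Matrix m p ℝ) (hA : IsUnit A₁.det) :
    (fromCols A₁ A₂ * (fromCols A₁ A₂)ᵀ).det = A₁.det ^ 2 * ((fromRows (-(A₁⁻¹ * A₂)) (1 : Matrix p p ℝ))ᵀ * fromRows (-(A₁⁻¹ * A₂)) (1 : Matrix p p ℝ)).det := by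
  rw [fromCols_mul_transpose_eq A₁ A₂ hA, transpose_graphC_mul_graphC, det_mul, det_mul, det_transpose, Matrix.det_one_add_mul_comm]
  ring

/-! ## §2  Against an orthonormal kernel basis -/

/-- If `N` has orthonormal columns and its projector fixes the graph columns (`N Nᵀ C = C`: the columns of `C` lie in the span of those of `N`, i.e. `N` spans the kernel), then
`det(NᵀC)² = det(CᵀC)`. [cite: Balaban1987RG1, (1.4) p.260 (bookkeeping)] -/
theorem det_transpose_mul_sq_of_orthonormal {ρ : Type*} [Fintype ρ] [DecidableEq ρ] (N : Matrix ρ p ℝ) (C : Matrix ρ p ℝ) (hN : Nᵀ * N = 1) (hNC : N * (Nᵀ * C) = C) :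
    (Nᵀ * C).det ^ 2 = (Cᵀ * C).det := by
  have h : Cᵀ * C = (Nᵀ * C)ᵀ * (Nᵀ * C) := by
    conv_lhs => rw [← hNC]
    rw [transpose_mul, transpose_mul, transpose_transpose]
    simp only [Matrix.mul_assoc]
    congr 1
    rw [← Matrix.mul_assoc Nᵀ N, hN, Matrix.one_mul]
  rw [h, det_mul, det_transpose, sq]

/-- ★ **`Z14` against the graph coordinates vs an orthonormal kernel basis**: `Z14 S C = Z14 S N ∕ √det(CᵀC)` (`C = N·(NᵀC)`, `Z14_basis_change`, `|det(NᵀC)| = √det(CᵀC)`).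
[cite: Balaban1987RG1, (1.4) p.260, p.268] -/
theorem Z14_graph_eq_of_orthonormal {ρ : Type*} [Fintype ρ] [DecidableEq ρ] (S : Matrix ρ ρ ℝ) (N : Matrix ρ p ℝ) (C : Matrix ρ p ℝ) (hN : Nᵀ * N = 1) (hNC : N * (Nᵀ * C) = C)
    (hpos : (Nᵀ * S * N).PosDef) (hC : IsUnit (Nᵀ * C).det) :
    B12Eq15QuadraticForm.Z14 S C = B12Eq15QuadraticForm.Z14 S N / Real.sqrt (Cᵀ * C).det := by
  have h := Z14_basis_change S N (Nᵀ * C) hpos hC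
  rw [hNC] at h
  rw [h, ← Real.sqrt_sq_eq_abs, det_transpose_mul_sq_of_orthonormal N C hN hNC]

/-! ## §3  ★★ The two (1.4) readings agree -/

/-- ★★ **COAREA = GRAPH**: for the linear constraint `Q̃ = [A₁ A₂]` (`A₁` = the `b₀`-block, invertible), an orthonormal kernel basis `N` (`NᵀN = 1`, `N Nᵀ C = C`) and the graph
parametrisation `C = [−A₁⁻¹A₂; 1]`: `(√det(Q̃Q̃ᵀ))⁻¹ · Z14 S N = |det A₁|⁻¹ · Z14 S C` — CRIT-1's `recordZkCan` and the computational `recordZkLoc` are ONE number, so the LZ localisation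
(which needs the local `C`) and the canonical SPLIT (which names `Z^{(k)}` by the coarea form) talk about the same `Z^{(k)}`. [cite: Balaban1987RG1, (1.4) p.260, p.267–268] -/
theorem zCan_eq_zLoc (S : Matrix (m ⊕ p) (m ⊕ p) ℝ) (A₁ : Matrix m m ℝ) (A₂ : Matrix m p ℝ) (hA : IsUnit A₁.det) (N : Matrix (m ⊕ p) p ℝ) (hN : Nᵀ * N = 1)
    (hNC : N * (Nᵀ * fromRows (-(A₁⁻¹ * A₂)) (1 : Matrix p p ℝ)) = fromRows (-(A₁⁻¹ * A₂)) (1 : Matrix p p ℝ)) (hpos : (Nᵀ * S * N).PosDef)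
    (hC : IsUnit (Nᵀ * fromRows (-(A₁⁻¹ * A₂)) (1 : Matrix p p ℝ)).det) :
    (Real.sqrt (fromCols A₁ A₂ * (fromCols A₁ A₂)ᵀ).det)⁻¹ * B12Eq15QuadraticForm.Z14 S N =
      |A₁.det|⁻¹ * B12Eq15QuadraticForm.Z14 S (fromRows (-(A₁⁻¹ * A₂)) (1 : Matrix p p ℝ)) := by
  have hG : 0 < ((fromRows (-(A₁⁻¹ * A₂)) (1 : Matrix p p ℝ))ᵀ * fromRows (-(A₁⁻¹ * A₂)) (1 : Matrix p p ℝ)).det := by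
    rw [← det_transpose_mul_sq_of_orthonormal N _ hN hNC]
    have hne : (Nᵀ * fromRows (-(A₁⁻¹ * A₂)) (1 : Matrix p p ℝ)).det ≠ 0 := hC.ne_zero
    positivity
  rw [Z14_graph_eq_of_orthonormal S N _ hN hNC hpos hC, det_fromCols_mul_transpose_eq A₁ A₂ hA, Real.sqrt_mul (sq_nonneg _), Real.sqrt_sq_eq_abs,
    mul_inv, div_eq_mul_inv]
  have hsq : Real.sqrt ((fromRows (-(A₁⁻¹ * A₂)) (1 : Matrix p p ℝ))ᵀ * fromRows (-(A₁⁻¹ * A₂)) (1 : Matrix p p ℝ)).det ≠ 0 := (Real.sqrt_pos.mpr hG).ne'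
  ring

/-! ## §4  (v2 APPEND) THE GRAM-NORMALISED GAUSSIAN IS BASIS-FREE — a canonical `Z^{(k)}` WITHOUT an orthonormal basis: `√det(CᵀC) · Z14 S C` does not change under `C ↦ C·A`
(`A` invertible), so DEF-1's EXISTING `recordCop` (any basis of `ker LQ̃`) already yields the object of record as `recordZkCan := (√det(LQ̃LQ̃ᵀ))⁻¹ · √det(CopᵀCop) · Z14 S Cop`
(= `(√det(LQ̃LQ̃ᵀ))⁻¹ · Z14 S N_on` for orthonormal `N_on`, where the Gram factor is `1`) — suggestion for ed.15d, no `N_on` carrier needed. -/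

omit [Fintype m] [DecidableEq m] in
/-- `det((C·A)ᵀ(C·A)) = (det A)² · det(CᵀC)` (Gram determinant under a basis change). [cite: Balaban1987RG1, (1.4) p.260 (bookkeeping)] -/
theorem det_gram_basis_change {ρ : Type*} [Fintype ρ] [DecidableEq ρ] (C : Matrix ρ p ℝ) (A : Matrix p p ℝ) :
    ((C * A)ᵀ * (C * A)).det = A.det ^ 2 * (Cᵀ * C).det := by
  have h := det_conj_basis (1 : Matrix ρ ρ ℝ) C A
  simpa only [Matrix.mul_one] using h

omit [Fintype m] [DecidableEq m] in
/-- ★ **THE GRAM-NORMALISED GAUSSIAN IS BASIS-FREE**: `√det((CA)ᵀ(CA)) · Z14 S (C·A) = √det(CᵀC) · Z14 S C` for `A` invertible and `CᵀSC` positive definite — so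
`(coarea Jacobian)⁻¹ · √det(CᵀC) · Z14 S C` is a CANONICAL reading of (1.4) for ANY kernel basis `C` (e.g. DEF-1's `recordCop`). [cite: Balaban1987RG1, (1.4) p.260, p.268] -/
theorem sqrt_gram_mul_Z14_basis_change {ρ : Type*} [Fintype ρ] [DecidableEq ρ] (S : Matrix ρ ρ ℝ) (C : Matrix ρ p ℝ) (A : Matrix p p ℝ)
    (h : (Cᵀ * S * C).PosDef) (hA : IsUnit A.det) :
    Real.sqrt ((C * A)ᵀ * (C * A)).det * B12Eq15QuadraticForm.Z14 S (C * A) = Real.sqrt (Cᵀ * C).det * B12Eq15QuadraticForm.Z14 S C := by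
  rw [Z14_basis_change S C A h hA, det_gram_basis_change, Real.sqrt_mul (sq_nonneg _), Real.sqrt_sq_eq_abs]
  have hA0 : |A.det| ≠ 0 := abs_ne_zero.mpr hA.ne_zero
  field_simp

omit [Fintype m] [DecidableEq m] in
/-- For an orthonormal-column basis the Gram factor is `1`: `√det(NᵀN) · Z14 S N = Z14 S N`. [cite: Balaban1987RG1, (1.4) p.260 (bookkeeping)] -/
theorem sqrt_gram_mul_Z14_of_orthonormal {ρ : Type*} [Fintype ρ] [DecidableEq ρ] (S : Matrix ρ ρ ℝ) (N : Matrix ρ p ℝ) (hN : Nᵀ * N = 1) :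
    Real.sqrt (Nᵀ * N).det * B12Eq15QuadraticForm.Z14 S N = B12Eq15QuadraticForm.Z14 S N := by
  rw [hN, det_one, Real.sqrt_one, one_mul]

end Summit.QuantumFields.YangMills.Theorems.BalabanUVNodesPortS1

end
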